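import Mathlib.FieldTheory.Galois.Abelian
import Mathlib.RingTheory.Norm.Defs
import Literature.NumberTheory.GaloisRepresentations.LocalGaloisGroup
import Literature.NumberTheory.GaloisRepresentations.LocalReciprocity
import Literature.NumberTheory.GaloisRepresentations.LocalExistenceReciprocity
import HarnessLib

/-!
# The reciprocity maps of the finite abelian extensions (Serre, *Local Fields*, Ch. XIII §4;
Cassels–Fröhlich Ch. VI §2): the finite-level input of `LocalReciprocity.lean`

Let `F` be a non-archimedean local field, `F̄ = AlgebraicClosure F`, `Γ_F = Gal(F̄/F)`.  For every
finite abelian (Galois) subextension `L/F` of `F̄`, local class field theory (Serre, *Local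
Fields*, Ch. XIII §4, from the class formation `(G_F, F_s^*)`, Thm. 1, via Tate's theorem) gives
the *norm residue symbol* `x ↦ (x, L/F)`, a homomorphism `ω_L : Fˣ → G(L/F)`, with:

* `ω_L` is surjective with kernel the norm group `N_{L/F} Lˣ` (XIII §4, Cor. to Prop. 8 and
  p. 197: `(x, L/F) = 1 ⟺ x ∈ N Lˣ`, "every `s ∈ G^a` is of the form `(x, L/F)`"; CF VI §2.2
  Thm. 2);
* compatibility in towers `L ⊆ L'`: `(x, L/F)` is the image of `(x, L'/F)` (XIII §4, Prop. 12;
  CF VI §2.3), which is what makes the limit `θ_F : Fˣ → G(F^ab/F)` (CF VI §2.3) well defined;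
* for `L/F` unramified, `(x, L/F) = F_F^{v(x)}`, `F_F` the (arithmetic) Frobenius (XIII §4,
  Prop. 13; CF VI §2.5 Prop. 2), and for every `L`, `ω_L(U_F)` is the inertia subgroup of
  `G(L/F)` (XIII §4, Cor. to Prop. 13; CF VI §2.5 Cor.);
* norm functoriality (XIII §4, Prop. 10 (a); in the limit CF VI §2.4, second diagram, valid also
  for inseparable `E/F`): `θ_F ∘ N_{E/F} = i ∘ θ_E`.

This file vendors these statements as one named fact about a *system* of finite-level maps
(`Literature.NumberTheory.GaloisRepresentations.IsReciprocitySystem`, `Literature.NumberTheory.GaloisRepresentations.exists_isReciprocitySystem`) and one about a pair of systems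
for a finite extension `E/F` (`Literature.NumberTheory.GaloisRepresentations.exists_isReciprocitySystem_normCompatible`).  The first three
clauses (surjective, kernel = norm group, compatibility in towers) are *literally* the tree's
named fact `Literature.localReciprocityLaw F` of `LocalExistenceReciprocity.lean` (Serre XIII §4 Cor. to
Prop. 8 and Prop. 12, vendored there for the existence theorem): `IsReciprocitySystem` **refines**
`localReciprocityLaw` by the Prop. 13 clauses (units onto inertia, uniformiser to Frobenius on
unramified levels), which the limit passage to `LocalReciprocity.lean` needs and the existence
theorem does not; `localReciprocityLaw_of_exists_isReciprocitySystem` is the bridge, so that the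
consequences proved there (`index_normSubgroup_eq_finrank_of_reciprocity`, …,
`localExistenceTheorem_of_reciprocityLaw`) are available from `exists_isReciprocitySystem`.
These facts are the input from which the facts `Literature.exists_isLocalReciprocityMap(_normCompatible)` of
`LocalReciprocity.lean` (the limit map `θ_F : Fˣ → Γ_F^ab` with its printed properties, Serre
XIV §6 Cor. 2 and Remark 2) are to be *proved* by passage to the limit, together with the
existence theorem (`LocalExistenceTheorem.lean`, XIV §6 Thm. 1) — decomposition step T2 of the
discharge of `Literature.NumberTheory.GaloisRepresentations.exists_isCompatible`.

## Faithfulness notes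

* As in `LocalReciprocity.lean`, Lean has no construction of `(x, L/F)` (no Brauer groups of local
  fields, cup products or Lubin–Tate theory at this pin), so the printed theorems are vendored as
  the *existence* of a system `ω` with the printed properties — weaker than, and implied by, the
  source, where `ω_L` is *the* norm residue symbol.
* The index set is the type of all intermediate fields `L` of `F̄/F`; the clauses only constrain
  the finite abelian ones (`[FiniteDimensional F L] [IsAbelianGalois F L]`, Mathlib).
* Galois groups of finite levels are reached from `Γ_F` by Mathlib's
  `AlgEquiv.restrictNormalHom L : Gal(F̄/F) →* Gal(L/F)` (surjective); compatibility in towers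
  (Prop. 12) is phrased through lifts to `Γ_F` ("any `γ ∈ Γ_F` restricting to `(x, L'/F)` on `L'`
  restricts to `(x, L/F)` on `L ⊆ L'`"), which is equivalent and avoids relative restriction maps.
* The inertia subgroup `T` of `G(L/F)` is rendered as the image of the absolute inertia group
  `I_F = Literature.absInertia F` (Serre, Ch. I §7, Prop. 22 (b): inertia groups map onto inertia groups
  in quotients), and "`L/F` unramified" as `I_F ≤ Gal(F̄/L)` (i.e. `L ⊆ F_nr`); the arithmetic
  Frobenius `F_F` of an unramified `L/F` is the restriction of any `φ ∈ Γ_F` with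
  `Literature.IsAbsArithFrob φ` (well defined because `I_F` acts trivially on `L`).  Prop. 13,
  `(x, L/F) = F_F^{v(x)}`, is stated through the homomorphism `ω_L` on uniformisers (`↦ F_F`);
  on units (`↦ 1 = F_F^0`) it already follows from the inertia clause, since the image of `I_F`
  in `G(L/F)` is trivial for unramified `L` (`IsReciprocitySystem.unramified_unit`, proved); the
  two together are equivalent to Prop. 13 since `x = u ϖ^{v(x)}`.
* Norm functoriality is stated in the limit form of CF VI §2.4 through representatives in the
  absolute Galois groups: for `x ∈ Eˣ` there is `γ ∈ Γ_E` representing `θ_E(x)` at every finite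
  abelian level of `E` (CF VI §2.3: the compatible system *defines* `θ_E`), whose restriction to
  `F̄` (`Literature.absGaloisRestrict F E`) represents `θ_F(N_{E/F} x)` at every finite abelian level of
  `F`.  This is exactly the commutativity `θ_F ∘ N_{E/F} = i ∘ θ_E` (and "the second diagram holds
  even in the inseparable case").

## Mathlib search

`rg -i "norm residue|reciprocity map|local class field|LubinTate|fundamental class"` over
Mathlib (this pin): nothing; Mathlib anchors used: `IsAbelianGalois`, `AlgEquiv.restrictNormalHom`,
`Algebra.norm`, `Valuation.IsUniformizer`, `Valuation.integer` unit group via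
`(valuation F).valuationSubring.unitGroup`.  Nothing here duplicates a Mathlib declaration.  In the
tree: `LocalExistenceTheorem.lean` has the norm-group side (`IsNormSubgroup`), and
`LocalExistenceReciprocity.lean` the fact `localReciprocityLaw` = the first three clauses below
(bridged, not restated independently: `localReciprocityLaw_of_exists_isReciprocitySystem`).

## References

* J.-P. Serre, *Local Fields*, GTM 67, Springer 1979, Ch. XIII §4: Thm. 1, Prop. 8 and Cor.,
  Prop. 9, Prop. 10, Prop. 12, Prop. 13 and Cor. (pp. 195–198); Ch. I §7, Prop. 22.
  [SerreLocalFields1979]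
* J.-P. Serre, *Local class field theory*, Ch. VI of Cassels–Fröhlich, *Algebraic Number Theory*
  (1967), §2.2 Thm. 2, §2.3 (incl. the definition of `θ_K`), §2.4 (diagrams), §2.5 Prop. 2 and
  Cor. (pp. 140–145 of the chapter; PDF pp. 183–185).  [CasselsFrohlichANT1967]
-/

noncomputable section

open ValuativeRel Field

namespace Literature.NumberTheory.GaloisRepresentations


section System

variable (F : Type*) [Field F] [ValuativeRel F] [TopologicalSpace F] [IsNonarchimedeanLocalField F]

/-- `IsReciprocitySystem F ω`: the family `ω L : Fˣ →* G(L/F)`, indexed by the subextensions `L`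
of `F̄/F`, has — on the finite abelian `L` — the printed properties of Serre's norm residue
symbols `x ↦ (x, L/F)`:
* `surjective`: every element of `G(L/F)` is an `(x, L/F)` (Serre XIII §4, p. 197; CF VI §2.2);
* `ker_eq`: `(x, L/F) = 1 ⟺ x ∈ N_{L/F} Lˣ` (XIII §4, Cor. to Prop. 8 and p. 197);
* `compatible`: for `L ⊆ L'`, `(x, L/F)` is the image of `(x, L'/F)` (XIII §4, Prop. 12), phrased
  through lifts to `Γ_F`;
* `map_unitGroup`: `ω_L(U_F)` is the inertia subgroup of `G(L/F)`, the image of `I_F`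
  (XIII §4, Cor. to Prop. 13; CF VI §2.5 Cor.);
* `unramified_uniformizer`: for `L/F` unramified (`I_F` acts trivially on `L`),
  `(ϖ, L/F) = F_F|_L` for uniformisers `ϖ`, `F_F` any arithmetic Frobenius of `Γ_F`; with
  `map_unitGroup` (units `↦ 1` on unramified `L`, `IsReciprocitySystem.unramified_unit`) this is
  `(x, L/F) = F_F^{v(x)}` (XIII §4, Prop. 13; CF VI §2.5 Prop. 2).
The first three clauses are the tree's `Literature.localReciprocityLaw F` (`LocalExistenceReciprocity`).
Ref: Serre, *Local Fields* (1979), Ch. XIII §4; Serre in Cassels–Fröhlich (1967), Ch. VI §2.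
[cite: SerreLocalFields1979, Ch. XIII §4 Prop. 8 Cor., Prop. 12, Prop. 13 and Cor.] -/
structure IsReciprocitySystem
    (ω : (L : IntermediateField F (AlgebraicClosure F)) → Fˣ →* (L ≃ₐ[F] L)) : Prop where
  /-- Every element of `G(L/F)` is a norm residue symbol `(x, L/F)`.
  Ref: Serre, *Local Fields*, Ch. XIII §4, p. 197. -/
  surjective : ∀ (L : IntermediateField F (AlgebraicClosure F)) [FiniteDimensional F L]
    [IsAbelianGalois F L], Function.Surjective (ω L)
  /-- `(x, L/F) = 1 ⟺ x ∈ N_{L/F} Lˣ`: the kernel of `ω_L` is the norm group.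
  Ref: Serre, *Local Fields*, Ch. XIII §4, Cor. to Prop. 8 and p. 197. -/
  ker_eq : ∀ (L : IntermediateField F (AlgebraicClosure F)) [FiniteDimensional F L]
    [IsAbelianGalois F L], (ω L).ker = (Units.map (Algebra.norm F : L →* F)).range
  /-- Compatibility in towers `L ⊆ L'` of finite abelian extensions: any `γ ∈ Γ_F` restricting to
  `(x, L'/F)` on `L'` restricts to `(x, L/F)` on `L`.
  Ref: Serre, *Local Fields*, Ch. XIII §4, Prop. 12. -/
  compatible : ∀ (L L' : IntermediateField F (AlgebraicClosure F)) [FiniteDimensional F L]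
    [IsAbelianGalois F L] [FiniteDimensional F L'] [IsAbelianGalois F L'], L ≤ L' →
    ∀ (x : Fˣ) (γ : absoluteGaloisGroup F),
      AlgEquiv.restrictNormalHom L' (absoluteGaloisGroup.toAlgEquiv F γ) = ω L' x →
      AlgEquiv.restrictNormalHom L (absoluteGaloisGroup.toAlgEquiv F γ) = ω L x
  /-- `ω_L` maps the unit group `U_F` onto the inertia subgroup of `G(L/F)` (the image of the
  absolute inertia group `I_F`).
  Ref: Serre, *Local Fields*, Ch. XIII §4, Cor. to Prop. 13 (with Ch. I §7, Prop. 22 (b)). -/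
  map_unitGroup : ∀ (L : IntermediateField F (AlgebraicClosure F)) [FiniteDimensional F L]
    [IsAbelianGalois F L],
    ((valuation F).valuationSubring.unitGroup).map (ω L) =
      (absInertia F).map ((AlgEquiv.restrictNormalHom L).comp
        (absoluteGaloisGroup.toAlgEquiv F).toMonoidHom)
  /-- For `L/F` unramified (`I_F` fixes `L`), a uniformiser is sent to the Frobenius of `L/F`,
  the restriction of any arithmetic Frobenius `φ ∈ Γ_F`: `(ϖ, L/F) = F_F`.
  Ref: Serre, *Local Fields*, Ch. XIII §4, Prop. 13 (`(x, L/K) = F^{v(x)}` with `v(ϖ) = 1`). -/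
  unramified_uniformizer : ∀ (L : IntermediateField F (AlgebraicClosure F))
    [FiniteDimensional F L] [IsAbelianGalois F L],
    (∀ σ ∈ absInertia F, ∀ x : L, σ • (x : AlgebraicClosure F) = x) →
    ∀ ϖ : Fˣ, (valuation F).IsUniformizer (ϖ : F) → ∀ φ : absoluteGaloisGroup F,
      IsAbsArithFrob φ → ω L ϖ = AlgEquiv.restrictNormalHom L (absoluteGaloisGroup.toAlgEquiv F φ)

/-- **Local class field theory at finite level** (existential form): for a non-archimedean local
field `F` there is a system of homomorphisms `ω_L : Fˣ → G(L/F)`, `L/F` finite abelian in `F̄`,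
with the printed properties of the norm residue symbols — surjective with kernel `N_{L/F} Lˣ`,
compatible in towers (these three: the tree's `localReciprocityLaw F`), units onto inertia, and
`(x, L/F) = F_F^{v(x)}` for unramified `L`.
In the source these are theorems about *the* symbols `(x, L/F) = θ_{L/F}⁻¹(x̄)` built from the
fundamental classes of the class formation `(G_F, F_s^*)` (XIII §4 Thm. 1, Tate's theorem).
Ref: Serre, *Local Fields* (1979), Ch. XIII §4, Thm. 1, Prop. 8 and Cor., Prop. 12, Prop. 13 and
Cor.; Serre in Cassels–Fröhlich (1967), Ch. VI §2.2–2.5.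
[cite: SerreLocalFields1979, Ch. XIII §4 Thm. 1, Prop. 8 Cor., Prop. 12, 13] -/
def exists_isReciprocitySystem : Prop :=
  ∃ ω : (L : IntermediateField F (AlgebraicClosure F)) → Fˣ →* (L ≃ₐ[F] L),
    IsReciprocitySystem F ω

variable {F} in
/-- **Bridge to `LocalExistenceReciprocity.lean`**: a reciprocity system gives the tree's fact
`localReciprocityLaw F` (its first three clauses), hence everything proved from it there
(`index_normSubgroup_eq_finrank_of_reciprocity`, `isNormSubgroup_inf_of_reciprocity`,
`isNormSubgroup_of_le_of_reciprocity`, `localExistenceTheorem_of_reciprocityLaw`).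
Ref: Serre, *Local Fields* (1979), Ch. XIII §4, Cor. to Prop. 8 and Prop. 12. [folklore] -/
theorem localReciprocityLaw_of_exists_isReciprocitySystem (h : exists_isReciprocitySystem F) :
    localReciprocityLaw F := by
  obtain ⟨ω, hω⟩ := h
  exact ⟨ω, fun L _ _ => ⟨hω.surjective L, hω.ker_eq L,
    fun L' _ _ hLL' x σ => hω.compatible L L' hLL' x σ⟩⟩

variable {F} in
/-- On an unramified `L` (`I_F` fixes `L` pointwise) units are killed, `(u, L/F) = 1`: the
image of `I_F` in `G(L/F)` is trivial, so this is a consequence of `map_unitGroup` (Serre's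
Prop. 13 at `v(u) = 0`).
Ref: Serre, *Local Fields* (1979), Ch. XIII §4, Prop. 13 and Cor. [folklore] -/
theorem IsReciprocitySystem.unramified_unit
    {ω : (L : IntermediateField F (AlgebraicClosure F)) → Fˣ →* (L ≃ₐ[F] L)}
    (hω : IsReciprocitySystem F ω) (L : IntermediateField F (AlgebraicClosure F))
    [FiniteDimensional F L] [IsAbelianGalois F L]
    (hL : ∀ σ ∈ absInertia F, ∀ x : L, σ • (x : AlgebraicClosure F) = x)
    (u : Fˣ) (hu : u ∈ (valuation F).valuationSubring.unitGroup) : ω L u = 1 := by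
  have h : ω L u ∈ ((valuation F).valuationSubring.unitGroup).map (ω L) := ⟨u, hu, rfl⟩
  rw [hω.map_unitGroup L] at h
  obtain ⟨σ, hσ, hσu⟩ := h
  rw [← hσu]
  refine AlgEquiv.ext fun x => Subtype.ext ?_
  change (AlgEquiv.restrictNormalHom L (absoluteGaloisGroup.toAlgEquiv F σ) x : AlgebraicClosure F)
    = x
  rw [AlgEquiv.restrictNormalHom_apply]
  exact hL σ hσ x

variable (E : Type*) [Field E] [ValuativeRel E] [TopologicalSpace E] [IsNonarchimedeanLocalField E]
  [Algebra F E]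

/-- **Norm functoriality of the norm residue symbols** (existential, limit form).  For a finite
extension `E/F` of non-archimedean local fields (the valuation of `E` extending that of `F`)
there are systems `ω^F`, `ω^E` as in `exists_isReciprocitySystem` such that for every `x ∈ Eˣ`
some `γ ∈ Γ_E` represents `θ_E(x)` — `γ|_{L'} = ω^E_{L'}(x)` for all finite abelian `L'/E` —
and its restriction to `F̄` (`absGaloisRestrict F E γ ∈ Γ_F`) represents `θ_F(N_{E/F} x)`:
`(res γ)|_L = ω^F_L(N_{E/F} x)` for all finite abelian `L/F`.  This is the commutative diagram
`θ_F ∘ N_{E/F} = i ∘ θ_E` of Cassels–Fröhlich Ch. VI §2.4 (second diagram, "holds even in the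
inseparable case"), i.e. Serre XIII §4 Prop. 10 (a) — the image of `(x, L''/E')` in `G^a_{L''/E}`
is `(N_{E'/E} x, L''/E)` — passed to the limit; the existence of the representative `γ` is CF VI
§2.3 (the compatible system defines `θ_E : Eˣ → G(E^ab/E)`).
Ref: Serre, *Local Fields* (1979), Ch. XIII §4, Prop. 10 (a); Serre in Cassels–Fröhlich (1967),
Ch. VI §2.3–2.4. [cite: SerreLocalFields1979, Ch. XIII §4 Prop. 10] -/
def exists_isReciprocitySystem_normCompatible [FiniteDimensional F E] [ValuativeExtension F E] :
    Prop :=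
  ∃ (ωF : (L : IntermediateField F (AlgebraicClosure F)) → Fˣ →* (L ≃ₐ[F] L))
    (ωE : (L' : IntermediateField E (AlgebraicClosure E)) → Eˣ →* (L' ≃ₐ[E] L')),
    IsReciprocitySystem F ωF ∧ IsReciprocitySystem E ωE ∧
    ∀ x : Eˣ, ∃ γ : absoluteGaloisGroup E,
      (∀ (L' : IntermediateField E (AlgebraicClosure E)) [FiniteDimensional E L']
        [IsAbelianGalois E L'],
        AlgEquiv.restrictNormalHom L' (absoluteGaloisGroup.toAlgEquiv E γ) = ωE L' x) ∧
      ∀ (L : IntermediateField F (AlgebraicClosure F)) [FiniteDimensional F L]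
        [IsAbelianGalois F L],
        AlgEquiv.restrictNormalHom L (absoluteGaloisGroup.toAlgEquiv F (absGaloisRestrict F E γ)) =
          ωF L (Units.map (Algebra.norm F : E →* F) x)

variable {F E} in
/-- The pair version contains the single-field facts (project to the components).
Ref: Serre, *Local Fields* (1979), Ch. XIII §4. [folklore] -/
theorem exists_isReciprocitySystem_of_normCompatible [FiniteDimensional F E]
    [ValuativeExtension F E] (h : exists_isReciprocitySystem_normCompatible F E) :
    exists_isReciprocitySystem F ∧ exists_isReciprocitySystem E := by
  obtain ⟨ωF, ωE, hF, hE, -⟩ := h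
  exact ⟨⟨ωF, hF⟩, ⟨ωE, hE⟩⟩

end System

end Literature.NumberTheory.GaloisRepresentations
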